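import Mathlib
import HarnessLib
import Summits.AtomisticToContinuum.FouriersLaw.Theses.JunctionLocality
import Summits.AtomisticToContinuum.FouriersLaw.Theorems.JunctionLocalitySuperadditiveResistanceStubPlainKuboLinkAux3
import Summits.AtomisticToContinuum.FouriersLaw.Theorems.JunctionLocalitySuperadditiveResistanceStubBypassBoundAux2
import Summits.AtomisticToContinuum.FouriersLaw.Theorems.OddSectorIrreversibilityResponseDensityBackwardLimit

/-!
# Kubo link of line `ForecastSensitivitySketch`, helper II: the odd-moment Kubo functional IS the
forward-field pairing (stub `stub_kuboLink`, crux stmt-AtomisticToContinuum-11749; equilibrium side)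

For the pinned anharmonic chain `pinnedChain ω₂ lam β γ` (all parameters `> 0`), `T > 0`, the Gibbs measure
`μ_T`, `k_b = p_b² − T`, the constructed equal-temperature kernels `P_u`, and a classical forward field `g` of
the LEFT bath (`C² ∩ L²(μ_T)`, mean zero, `L_{T,T} g = −k_0` pointwise):

* `exists_forwardField_ae_eq_poissonField`, `forwardField_ae_eq_poissonField` — `g` agrees Lebesgue-a.e.
  with the semigroup Poisson field `G = ∫_{u>0} P_u k_0 du` of the sibling helper `…StubPlainKuboLinkAux2`
  (the construction of `exists_forwardField_pairing` re-run with the a.e. identification exported — Poisson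
  equation in `𝓓'`, Hörmander regularity — then the landed uniqueness `plainForwardField_unique'`);
* `integral_mul_forwardField_eq` — hence the GENERAL Green–Kubo pairing
  `∫ h g dμ_T = ∫_{u>0} ∫ h · P_u k_0 dμ_T du` for every continuous `|h| ≤ M' e^{ϑ'H}`, `1/(4T) + ϑ' < 1/T`
  (Fubini, `integral_mul_poissonField`);
* `integral_gibbsWeight_mul_eq` — `∫ e^{−H/T} F dx = Z ∫ F dμ_T` (`gibbsMeasure = volume.tilted (−H/T)`);
* `oddMomentKubo_eq` — for `L ≥ 2`, the limit functional of the landed linear response at the observable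
  `k_0` (`pinnedChain_linear_response_of_uniformMixing`, route `OddSectorIrreversibility`, item 9144) is the
  forward-field pairing:
  `∫_{s>0} ∫ (P_s k_0)(x) e^{−H(x)/T} (p_0² − p_{L−1}²) dx ds = Z · (⟨g, k_0⟩_{μ_T} − ⟨g, k_{L−1}⟩_{μ_T})`.

The NESS side (the Kubo link from `δ`-uniform mixing) is helper III. References: Rey-Bellet 2003, Rem. 4.4;
Kundu–Dhar–Narayan 2009 (open-system Green–Kubo); Cuneo–Eckmann–Hairer–Rey-Bellet 2018, Thm 2.13.
-/

noncomputable section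

open MeasureTheory Filter Topology Set ProbabilityTheory
open scoped ContDiff NNReal ENNReal
open Literature.MathematicalPhysics.KineticTheory.HeatConduction
open Literature.MathematicalPhysics.KineticTheory Literature.Probability.Process OscillatorChain
open Literature.Analysis.Distribution
open Summit.AtomisticToContinuum.FouriersLaw.Theorems
open Summit.AtomisticToContinuum.FouriersLaw.Theorems.SubdiffusiveBondHeat
open Summit.AtomisticToContinuum.FouriersLaw.Theorems.SuperadditiveResistance.PlainForwardField
open Summit.AtomisticToContinuum.FouriersLaw.Theorems.SuperadditiveResistance.DeviceLiouville (kin kin_eq_sq)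
open Summit.AtomisticToContinuum.FouriersLaw.Cruxes.SuperadditiveResistance.FloatingProbeBypassLaplacian

namespace Summit.AtomisticToContinuum.FouriersLaw.Cruxes.ConductanceLowerBound.ForecastSensitivity

/-! ## The forward field is the semigroup Poisson field (a.e.), and its general Green–Kubo pairing -/

section PoissonField

variable {ω₂ lam β γ : ℝ} (hω : 0 < ω₂) (hl : 0 ≤ lam) (hβ : 0 < β) (hγ : 0 < γ) {L : ℕ} (hL : 0 < L)
  {T : ℝ} (hT : 0 < T)
include hω hl hβ hγ hL hT

/-- **The semigroup forward field, with its a.e. identification exported.** There is a smooth, mean-zero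
`g ∈ L²(μ_T)` with `L_{T,T} g = −(p_0² − T)` pointwise which agrees Lebesgue-a.e. with the Poisson field
`G = ∫_{u>0} (P_u k_0 − μ_T k_0) du` of helper `…StubPlainKuboLinkAux2` (`k_0 = p_0² − T`). -/
theorem exists_forwardField_ae_eq_poissonField :
    ∃ g : PhaseSpace L → ℝ, ContDiff ℝ ∞ g ∧ MemLp g 2 ((pinnedChain ω₂ lam β γ).gibbsMeasure L T) ∧
      ∫ x, g x ∂((pinnedChain ω₂ lam β γ).gibbsMeasure L T) = 0 ∧
      (∀ x, (pinnedChain ω₂ lam β γ).generator L T T g x = -(x.2 ⟨0, hL⟩ ^ 2 - T)) ∧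
      poissonField ω₂ lam β γ T L (fun y => y.2 ⟨0, hL⟩ ^ 2 - T) =ᵐ[volume] g := by
  -- adapted from `exists_forwardField_pairing` (…StubPlainKuboLinkAux3): same construction, a.e. equality kept
  haveI := isAddHaarMeasure_volume_phaseSpace L
  set P := pinnedChain ω₂ lam β γ with hP
  set μ := P.gibbsMeasure L T with hμ
  haveI : IsProbabilityMeasure μ := pinnedChain_isProbabilityMeasure_gibbsMeasure hω hl hβ.le γ L hT
  have hU : ContDiff ℝ ∞ P.U := pinnedChain_contDiff_U ω₂ lam β γ
  have hV : ContDiff ℝ ∞ P.V := pinnedChain_contDiff_V ω₂ lam β γ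
  have hγ' : P.γ = γ := rfl
  have hγT : 0 ≤ P.γ * T := by rw [hγ']; positivity
  set ϑ : ℝ := 1 / (4 * T) with hϑ
  have hϑ0 : 0 < ϑ := by positivity
  have hϑ1 : ϑ < 1 / T := by rw [hϑ, div_lt_div_iff₀ (by positivity) hT]; nlinarith
  have h2ϑ : 2 * ϑ < 1 / T := by
    rw [hϑ, show 2 * (1 / (4 * T)) = 1 / (2 * T) by field_simp; ring, div_lt_div_iff₀ (by positivity) hT]
    nlinarith
  set M : ℝ := 2 / ϑ + T with hM
  have hM0 : 0 < M := by positivity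
  set k : PhaseSpace L → ℝ := fun y => y.2 ⟨0, hL⟩ ^ 2 - T with hk
  have hks : ContDiff ℝ ∞ k := by rw [hk]; fun_prop
  have hkc : Continuous k := hks.continuous
  have hkb : ∀ y, |k y| ≤ M * Real.exp (ϑ * P.hamiltonian L y) := fun y =>
    abs_sq_momentum_sub_le_exp hω hl hβ.le hϑ0 hT.le y ⟨0, hL⟩
  have hk0 : ∫ y, k y ∂μ = 0 := pinnedChain_integral_kinObs_gibbsMeasure hω hl hβ.le γ L hT ⟨0, hL⟩
  set G : PhaseSpace L → ℝ := poissonField ω₂ lam β γ T L k with hG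
  have hGm : StronglyMeasurable G := stronglyMeasurable_poissonField hω hl hβ.le hγ.le hkc
  obtain ⟨C, hC, hGb⟩ := abs_poissonField_le hω hl hβ hγ hL hT hϑ0 hϑ1
  have hGb' : ∀ x, |G x| ≤ M * C * Real.exp (ϑ * P.hamiltonian L x) := fun x => hGb M hM0 k hkc hkb x
  have hGL2 : MemLp G 2 μ := memLp_poissonField hω hl hβ hγ hL hT hϑ0 h2ϑ hM0 hkc hkb
  have hGmean : ∫ x, G x ∂μ = 0 := integral_poissonField hω hl hβ hγ hL hT hϑ0 hϑ1 hM0 hkc hkb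
  have hGeq : G = fun x => ∫ t in Ioi (0 : ℝ), ∫ y, k y ∂(P.langevinKernel L T T t.toNNReal x) := by
    funext x
    simp only [hG, poissonField_apply]
    refine integral_congr_ae (ae_of_all _ fun t => ?_)
    dsimp only
    rw [actCentered_apply, hk0, sub_zero, pinnedChain_langevinKernel_eq_transitionKernel L T T hω hl hβ.le hγ.le]
  obtain ⟨C₁, c, -, hc, hdec⟩ := abs_actCentered_le hω hl hβ hγ hL hT hϑ0 hϑ1
  have hdecay : ∀ (t : ℝ≥0) (z : PhaseSpace L), |∫ y, k y ∂(P.langevinKernel L T T t z)| ≤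
      M * C₁ * Real.exp (ϑ * P.hamiltonian L z) * Real.exp (-c * t) := by
    intro t z
    have h := hdec M hM0 k hkc hkb z t
    rw [actCentered_apply, hk0, sub_zero, Real.toNNReal_coe] at h
    rwa [pinnedChain_langevinKernel_eq_transitionKernel L T T hω hl hβ.le hγ.le]
  set B : PhaseSpace L → ℝ := fun x => M * C * Real.exp (ϑ * P.hamiltonian L x) with hB
  have hBc : Continuous B := by
    have := pinnedChain_continuous_hamiltonian ω₂ lam β γ L
    rw [hB]; fun_prop
  have hGB : ∀ x, ‖G x‖ ≤ ‖B x‖ := fun x => by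
    rw [Real.norm_eq_abs, Real.norm_eq_abs]
    exact (hGb' x).trans (le_abs_self _)
  have hGloc : LocallyIntegrable G volume :=
    hBc.locallyIntegrable.mono hGm.aestronglyMeasurable (Eventually.of_forall hGB)
  have hweak₀ : ∀ φ : PhaseSpace L → ℝ, ContDiff ℝ ∞ φ → HasCompactSupport φ →
      ∫ x, G x * hormanderTranspose (P.drift L) (P.bathField hL T T) (fun _ => 0) φ x =
        ∫ x, (-k x) * φ x := by
    intro φ hφ hφc
    have h := integral_transpose_mul_forwardIntegral hω hl hβ.le hγ.le hL hT hϑ0 hϑ1 hc hks hkb hdecay hφ hφc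
    have hGx : ∀ x, G x = ∫ t in Ioi (0 : ℝ), ∫ y, k y ∂(P.langevinKernel L T T t.toNNReal x) :=
      fun x => congrFun hGeq x
    calc ∫ x, G x * hormanderTranspose (P.drift L) (P.bathField hL T T) (fun _ => 0) φ x
        = ∫ x, (sdeGenerator (fun y => -P.drift L y) (P.bathVecL L T) (P.bathVecR L T) φ x +
            2 * γ * φ x) * ∫ t in Ioi (0 : ℝ), ∫ y, k y ∂(P.langevinKernel L T T t.toNNReal x) := by
          refine integral_congr_ae (ae_of_all _ fun x => ?_)
          dsimp only
          rw [hormanderTranspose_generatorFamily_eq_revGenerator P hU hV hL hγT hγT hφ x, hγ', mul_comm,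
            hGx x]
      _ = -∫ x, φ x * k x := h
      _ = ∫ x, (-k x) * φ x := by
          rw [← integral_neg]
          exact integral_congr_ae (ae_of_all _ fun x => by ring)
  obtain ⟨g, hg, hae⟩ := exists_smooth_ae_eq_of_weak_poisson hβ.le hγ hL hT hGloc hks.neg hweak₀
  have hweak : ∀ φ : PhaseSpace L → ℝ, ContDiff ℝ ∞ φ → HasCompactSupport φ →
      ∫ x, g x * hormanderTranspose (P.drift L) (P.bathField hL T T) (fun _ => 0) φ x =
        ∫ x, (-k x) * φ x := by
    intro φ hφ hφc
    rw [← hweak₀ φ hφ hφc]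
    refine integral_congr_ae ?_
    filter_upwards [hae] with x hx
    rw [hx]
  have hclass : ∀ x, P.generator L T T g x = -k x :=
    generator_eq_of_weak_poisson P hU hV hL hγT hγT hg hkc.neg hweak
  have haeμ : G =ᵐ[μ] g := (P.gibbsMeasure_absolutelyContinuous L T).ae_le hae
  have hgL2 : MemLp g 2 μ := (memLp_congr_ae haeμ).1 hGL2
  have hgmean : ∫ x, g x ∂μ = 0 := by rw [← integral_congr_ae haeμ]; exact hGmean
  exact ⟨g, hg, hgL2, hgmean, hclass, hae⟩

/-- **Every classical forward field of the left bath is the semigroup Poisson field, Lebesgue-a.e.**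
(`L ≥ 1`): uniqueness of classical forward fields (`plainForwardField_unique'`) identifies `g` with the
smooth representative of `exists_forwardField_ae_eq_poissonField`. -/
theorem forwardField_ae_eq_poissonField {g : PhaseSpace L → ℝ} (hC : ContDiff ℝ 2 g)
    (hL2 : MemLp g 2 ((pinnedChain ω₂ lam β γ).gibbsMeasure L T))
    (hmean : ∫ x, g x ∂((pinnedChain ω₂ lam β γ).gibbsMeasure L T) = 0)
    (hpde : ∀ x, (pinnedChain ω₂ lam β γ).generator L T T g x = -(kin L 0 x - T)) :
    poissonField ω₂ lam β γ T L (fun y => y.2 ⟨0, hL⟩ ^ 2 - T) =ᵐ[volume] g := by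
  obtain ⟨g', hg', hL2', hmean', hpde', hae'⟩ := exists_forwardField_ae_eq_poissonField hω hl hβ hγ hL hT
  have hpde'' : ∀ x, (pinnedChain ω₂ lam β γ).generator L T T g' x = -(kin L 0 x - T) := fun x => by
    rw [hpde' x, kin_eq_sq hL]
  have heq : g = g' := plainForwardField_unique' hω hl hβ.le hγ hL hT 0 hC hL2 hmean hpde
    (hg'.of_le (by norm_cast)) hL2' hmean' hpde''
  rw [heq]
  exact hae'

/-- **General Green–Kubo pairing of the forward field**: for every classical forward field `g` of the
left bath and every continuous `h` with `|h| ≤ M' e^{ϑ'H}`, `0 ≤ ϑ'`, `1/(4T) + ϑ' < 1/T`: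
`∫ h g dμ_T = ∫_{u>0} ∫ h(z) (P_u k_0)(z) dμ_T(z) du` (`k_0 = p_0² − T`, `μ_T(k_0) = 0`), with `h·g ∈ L¹(μ_T)`. -/
theorem integral_mul_forwardField_eq {g : PhaseSpace L → ℝ} (hC : ContDiff ℝ 2 g)
    (hL2 : MemLp g 2 ((pinnedChain ω₂ lam β γ).gibbsMeasure L T))
    (hmean : ∫ x, g x ∂((pinnedChain ω₂ lam β γ).gibbsMeasure L T) = 0)
    (hpde : ∀ x, (pinnedChain ω₂ lam β γ).generator L T T g x = -(kin L 0 x - T))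
    {ϑ' M' : ℝ} (hϑ'0 : 0 ≤ ϑ') (hsum : 1 / (4 * T) + ϑ' < 1 / T) {h : PhaseSpace L → ℝ}
    (hh : Continuous h) (hhb : ∀ y, |h y| ≤ M' * Real.exp (ϑ' * (pinnedChain ω₂ lam β γ).hamiltonian L y)) :
    Integrable (fun z => h z * g z) ((pinnedChain ω₂ lam β γ).gibbsMeasure L T) ∧
    ∫ z, h z * g z ∂((pinnedChain ω₂ lam β γ).gibbsMeasure L T) =
      ∫ u in Ioi (0 : ℝ), ∫ z, h z * (∫ y, (y.2 ⟨0, hL⟩ ^ 2 - T)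
        ∂((pinnedChain ω₂ lam β γ).transitionKernel L T T u.toNNReal z))
        ∂((pinnedChain ω₂ lam β γ).gibbsMeasure L T) := by
  set P := pinnedChain ω₂ lam β γ with hP
  set μ := P.gibbsMeasure L T with hμ
  set ϑ : ℝ := 1 / (4 * T) with hϑ
  have hϑ0 : 0 < ϑ := by positivity
  set M : ℝ := 2 / ϑ + T with hM
  have hM0 : 0 < M := by positivity
  set k : PhaseSpace L → ℝ := fun y => y.2 ⟨0, hL⟩ ^ 2 - T with hk
  have hkc : Continuous k := by rw [hk]; fun_prop
  have hkb : ∀ y, |k y| ≤ M * Real.exp (ϑ * P.hamiltonian L y) := fun y =>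
    abs_sq_momentum_sub_le_exp hω hl hβ.le hϑ0 hT.le y ⟨0, hL⟩
  have hk0 : ∫ y, k y ∂μ = 0 := pinnedChain_integral_kinObs_gibbsMeasure hω hl hβ.le γ L hT ⟨0, hL⟩
  obtain ⟨hint, hfub⟩ := integral_mul_poissonField hω hl hβ hγ hL hT hϑ0 hϑ'0 hsum hM0 hkc hkb hh hhb
  have hae : poissonField ω₂ lam β γ T L k =ᵐ[μ] g :=
    (P.gibbsMeasure_absolutelyContinuous L T).ae_le (forwardField_ae_eq_poissonField hω hl hβ hγ hL hT hC hL2 hmean hpde)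
  have hae' : (fun z => h z * poissonField ω₂ lam β γ T L k z) =ᵐ[μ] fun z => h z * g z := by
    filter_upwards [hae] with z hz
    rw [hz]
  refine ⟨(integrable_congr hae').1 hint, ?_⟩
  rw [← integral_congr_ae hae', hfub]
  refine integral_congr_ae (ae_of_all _ fun u => ?_)
  refine integral_congr_ae (ae_of_all _ fun z => ?_)
  dsimp only
  rw [actCentered_apply, hk0, sub_zero]

end PoissonField

/-! ## The odd-moment Kubo functional is the forward-field pairing -/

section OddMoment

variable {ω₂ lam β γ : ℝ} (hω : 0 < ω₂) (hl : 0 ≤ lam) (hβ : 0 < β) (hγ : 0 < γ) {L : ℕ} (hL2 : 2 ≤ L)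
  {T : ℝ} (hT : 0 < T)
include hω hl hβ hγ hL2 hT

omit hγ hL2 in
/-- **Gibbs weight versus Gibbs measure**: `∫ e^{−H/T} F dx = Z ∫ F dμ_T`, `Z = ∫ e^{−H/T} dx`
(`gibbsMeasure = volume.tilted (−H/T)`, Mathlib's `integral_tilted`). [folklore] -/
theorem integral_gibbsWeight_mul_eq (F : PhaseSpace L → ℝ) :
    ∫ x, Real.exp (-1 / T * (pinnedChain ω₂ lam β γ).hamiltonian L x) * F x =
      (∫ x, Real.exp (-1 / T * (pinnedChain ω₂ lam β γ).hamiltonian L x)) *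
        ∫ x, F x ∂((pinnedChain ω₂ lam β γ).gibbsMeasure L T) := by
  have hIθ := integrable_exp_mul_hamiltonian hω hl hβ.le γ (N := L) (c := -1 / T)
    (by rw [neg_div]; exact neg_neg_of_pos (one_div_pos.2 hT))
  have e' : (fun x : PhaseSpace L => -(pinnedChain ω₂ lam β γ).hamiltonian L x / T) =
      fun x => -1 / T * (pinnedChain ω₂ lam β γ).hamiltonian L x := by
    funext x; ring
  rw [OscillatorChain.gibbsMeasure_eq, e', integral_tilted]
  set Z : ℝ := ∫ x, Real.exp (-1 / T * (pinnedChain ω₂ lam β γ).hamiltonian L x) with hZdef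
  have hZ : 0 < Z := integral_exp_pos hIθ
  clear_value Z
  rw [← integral_const_mul]
  refine integral_congr_ae (ae_of_all _ fun x => ?_)
  dsimp only
  rw [smul_eq_mul, div_mul_eq_mul_div (Real.exp _) Z (F x), mul_div_cancel₀ _ hZ.ne']

/-- **The odd-moment Kubo functional at `k_0` is the forward-field pairing.** For every classical forward
field `g` of the left bath of the `L`-chain (`L ≥ 2`):
`∫_{s>0} ∫ (P_s k_0)(x) · e^{−H(x)/T} (p_0² − p_{L−1}²) dx ds = Z (⟨g, k_0⟩_{μ_T} − ⟨g, k_{L−1}⟩_{μ_T})`,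
`Z = ∫ e^{−H/T} dx` — the general Green–Kubo pairing with `h = p_0² − p_{L−1}² = k_0 − k_{L−1}`. -/
theorem oddMomentKubo_eq {g : PhaseSpace L → ℝ} (hC : ContDiff ℝ 2 g)
    (hgL2 : MemLp g 2 ((pinnedChain ω₂ lam β γ).gibbsMeasure L T))
    (hmean : ∫ x, g x ∂((pinnedChain ω₂ lam β γ).gibbsMeasure L T) = 0)
    (hpde : ∀ x, (pinnedChain ω₂ lam β γ).generator L T T g x = -(kin L 0 x - T)) :
    ∫ s in Ioi (0 : ℝ), ∫ x, (∫ y, (y.2 ⟨0, by omega⟩ ^ 2 - T)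
          ∂((pinnedChain ω₂ lam β γ).transitionKernel L T T s.toNNReal x)) *
        (Real.exp (-1 / T * (pinnedChain ω₂ lam β γ).hamiltonian L x) *
          (x.2 ⟨0, by omega⟩ ^ 2 - x.2 ⟨L - 1, by omega⟩ ^ 2)) =
      (∫ x, Real.exp (-1 / T * (pinnedChain ω₂ lam β γ).hamiltonian L x)) *
        ((∫ x, g x * (kin L 0 x - T) ∂((pinnedChain ω₂ lam β γ).gibbsMeasure L T)) -
          ∫ x, g x * (kin L (L - 1) x - T) ∂((pinnedChain ω₂ lam β γ).gibbsMeasure L T)) := by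
  have hL : 0 < L := by omega
  have hL1 : L - 1 < L := by omega
  set P := pinnedChain ω₂ lam β γ with hP
  set μ := P.gibbsMeasure L T with hμ
  haveI : IsProbabilityMeasure μ := pinnedChain_isProbabilityMeasure_gibbsMeasure hω hl hβ.le γ L hT
  set Z : ℝ := ∫ x, Real.exp (-1 / T * P.hamiltonian L x) with hZ
  -- the weight `h = p_0² − p_{L−1}²` and its exponential bound with `ϑ' = 1/(4T)`
  set ϑ' : ℝ := 1 / (4 * T) with hϑ'
  have hϑ'0 : 0 < ϑ' := by positivity
  have hsum : 1 / (4 * T) + ϑ' < 1 / T := by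
    rw [hϑ', show 1 / (4 * T) + 1 / (4 * T) = 1 / (2 * T) by field_simp; ring,
      div_lt_div_iff₀ (by positivity) hT]
    nlinarith
  set h : PhaseSpace L → ℝ := fun x => x.2 ⟨0, hL⟩ ^ 2 - x.2 ⟨L - 1, hL1⟩ ^ 2 with hh
  have hhc : Continuous h := by rw [hh]; fun_prop
  set M' : ℝ := 2 * (2 / ϑ' + T) with hM'
  have hhb : ∀ y, |h y| ≤ M' * Real.exp (ϑ' * P.hamiltonian L y) := by
    intro y
    have h0 := abs_sq_momentum_sub_le_exp hω hl hβ.le hϑ'0 hT.le y ⟨0, hL⟩ (γ := γ)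
    have h1 := abs_sq_momentum_sub_le_exp hω hl hβ.le hϑ'0 hT.le y ⟨L - 1, hL1⟩ (γ := γ)
    have e : h y = (y.2 ⟨0, hL⟩ ^ 2 - T) - (y.2 ⟨L - 1, hL1⟩ ^ 2 - T) := by rw [hh]; ring
    rw [e, hM']
    calc |(y.2 ⟨0, hL⟩ ^ 2 - T) - (y.2 ⟨L - 1, hL1⟩ ^ 2 - T)|
        ≤ |y.2 ⟨0, hL⟩ ^ 2 - T| + |y.2 ⟨L - 1, hL1⟩ ^ 2 - T| := abs_sub _ _
      _ ≤ _ := by linarith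
  obtain ⟨hint, hfub⟩ := integral_mul_forwardField_eq hω hl hβ hγ hL hT hC hgL2 hmean hpde hϑ'0.le hsum hhc hhb
  -- the inner `dx`-integral at each time `s` is `Z ∫ h (P_s k_0) dμ_T`
  have hinner : ∀ s : ℝ, ∫ x, (∫ y, (y.2 ⟨0, hL⟩ ^ 2 - T) ∂(P.transitionKernel L T T s.toNNReal x)) *
        (Real.exp (-1 / T * P.hamiltonian L x) * h x) =
      Z * ∫ x, h x * (∫ y, (y.2 ⟨0, hL⟩ ^ 2 - T) ∂(P.transitionKernel L T T s.toNNReal x)) ∂μ := by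
    intro s
    rw [← integral_gibbsWeight_mul_eq hω hl hβ hT]
    refine integral_congr_ae (ae_of_all _ fun x => ?_)
    dsimp only
    ring
  calc ∫ s in Ioi (0 : ℝ), ∫ x, (∫ y, (y.2 ⟨0, hL⟩ ^ 2 - T) ∂(P.transitionKernel L T T s.toNNReal x)) *
          (Real.exp (-1 / T * P.hamiltonian L x) * (x.2 ⟨0, hL⟩ ^ 2 - x.2 ⟨L - 1, hL1⟩ ^ 2))
      = ∫ s in Ioi (0 : ℝ), Z * ∫ x, h x * (∫ y, (y.2 ⟨0, hL⟩ ^ 2 - T)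
          ∂(P.transitionKernel L T T s.toNNReal x)) ∂μ := by
        refine integral_congr_ae (ae_of_all _ fun s => ?_)
        exact hinner s
    _ = Z * ∫ x, h x * g x ∂μ := by rw [integral_const_mul, hfub]
    _ = Z * ((∫ x, g x * (kin L 0 x - T) ∂μ) - ∫ x, g x * (kin L (L - 1) x - T) ∂μ) := by
        congr 1
        have hsq0 : MemLp (fun x : PhaseSpace L => x.2 ⟨0, hL⟩ ^ 2 - T) 2 μ :=
          (pinnedChain_memLp_two_snd_sq hω hl hβ.le γ L hT ⟨0, hL⟩).sub (memLp_const T)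
        have hsq1 : MemLp (fun x : PhaseSpace L => x.2 ⟨L - 1, hL1⟩ ^ 2 - T) 2 μ :=
          (pinnedChain_memLp_two_snd_sq hω hl hβ.le γ L hT ⟨L - 1, hL1⟩).sub (memLp_const T)
        have hi0 : Integrable (fun x => g x * (x.2 ⟨0, hL⟩ ^ 2 - T)) μ := hgL2.integrable_mul hsq0
        have hi1 : Integrable (fun x => g x * (x.2 ⟨L - 1, hL1⟩ ^ 2 - T)) μ := hgL2.integrable_mul hsq1
        have e0 : (fun x => g x * (kin L 0 x - T)) = fun x => g x * (x.2 ⟨0, hL⟩ ^ 2 - T) := by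
          funext x; rw [kin_eq_sq hL]
        have e1 : (fun x => g x * (kin L (L - 1) x - T)) = fun x => g x * (x.2 ⟨L - 1, hL1⟩ ^ 2 - T) := by
          funext x; rw [kin_eq_sq hL1]
        rw [e0, e1, ← integral_sub hi0 hi1]
        refine integral_congr_ae (ae_of_all _ fun x => ?_)
        simp only [hh]
        ring

end OddMoment

/-! ## Registered sub-goal -/

/-- **Registered sub-goal `helper_kuboOddMomentKubo`** (wave-2 helper II of stub `stub_kuboLink`, crux
stmt-AtomisticToContinuum-11749): the odd-moment Kubo functional of the landed linear response at `k_0` is the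
forward-field pairing, `∫_{s>0} ∫ (P_s k_0) e^{−H/T} (p_0² − p_{L−1}²) dx ds = Z (⟨g,k_0⟩ − ⟨g,k_{L−1}⟩)`
(`oddMomentKubo_eq`, closed form). -/
theorem helper_kuboOddMomentKubo : ∀ {ω₂ lam β γ : ℝ}, 0 < ω₂ → 0 ≤ lam → 0 < β → 0 < γ → ∀ {L : ℕ} (hL2 : 2 ≤ L) {T : ℝ}, 0 < T → ∀ {g : PhaseSpace L → ℝ}, ContDiff ℝ 2 g → MemLp g 2 ((pinnedChain ω₂ lam β γ).gibbsMeasure L T) → ∫ x, g x ∂((pinnedChain ω₂ lam β γ).gibbsMeasure L T) = 0 → (∀ x, (pinnedChain ω₂ lam β γ).generator L T T g x = -(kin L 0 x - T)) → ∫ s in Set.Ioi (0 : ℝ), ∫ x, (∫ y, (y.2 ⟨0, by omega⟩ ^ 2 - T) ∂((pinnedChain ω₂ lam β γ).transitionKernel L T T s.toNNReal x)) * (Real.exp (-1 / T * (pinnedChain ω₂ lam β γ).hamiltonian L x) * (x.2 ⟨0, by omega⟩ ^ 2 - x.2 ⟨L - 1, by omega⟩ ^ 2)) = (∫ x, Real.exp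 (-1 / T * (pinnedChain ω₂ lam β γ).hamiltonian L x)) * ((∫ x, g x * (kin L 0 x - T) ∂((pinnedChain ω₂ lam β γ).gibbsMeasure L T)) - ∫ x, g x * (kin L (L - 1) x - T) ∂((pinnedChain ω₂ lam β γ).gibbsMeasure L T)) := by
  intro ω₂ lam β γ hω hl hβ hγ L hL2 T hT g hC hgL2 hmean hpde
  exact oddMomentKubo_eq hω hl hβ hγ hL2 hT hC hgL2 hmean hpde

end Summit.AtomisticToContinuum.FouriersLaw.Cruxes.ConductanceLowerBound.ForecastSensitivity

end
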